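import Summits.CriticalPhenomena.PercolationContinuityZ3.Theorems.Transplant.SkelFrmBParamsFramesF
import Summits.CriticalPhenomena.PercolationContinuityZ3.Theorems.Transplant.SkelFrmBParamsSlotsF
import Summits.CriticalPhenomena.PercolationContinuityZ3.Theorems.Transplant.SkelNegBParamsFaceY
import Summits.CriticalPhenomena.PercolationContinuityZ3.Theorems.Transplant.PlanarSkeletonFrmDefs
import Summits.CriticalPhenomena.PercolationContinuityZ3.Theorems.Transplant.SkelPhiStepIDataNS
import HarnessLib
/-!
(F) VALUE LAYER, N2 twin (hp-8 g42, 2026-08-23; F-DISCHARGE-MAP-N2 G8/G18 origins, transposed cases): `port_frm.py` text of N1 `SkelNegBParamsFramesF2` (stmt-g16) over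
`SkelFrmBParamsFramesF` / `SkelFrmBParamsSlotsF` (hp-8 g42) — `mem_core1F_side_iff/top_iff`, `SF_int`, `yLFof/yLFof_zero/yLFof_eq`, `hxaF_of/hxbF_of`, `KS.yLFd/yLFt`,
`yLFd_zero/yLFt_zero`, `widthF_dt_le`, `hxaF_d/hxbF_d`, `hxaF_t/hxbF_t`; kit level radius re-pointed `RA′ ↦ KS0.R'0`; the n_L floor `2000·(RA′+2) ≤ n_L` (N1
`nL_floorT_int`) becomes the explicit hypothesis `(h3R0 : 2000·(R'0+2) ≤ n_L)` of `widthF_dt_le`/`hxaF_d`/`hxaF_t` (a slot floor ⟸ stmt's `hg2`-type floors; S2/S4 of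
lane 07:54:36Z); `hxbY_core` = N1's carrier-free lemma (SkelNegBParamsFaceY). Statements/proofs otherwise verbatim.
NON-VACUITY: definitions + arithmetic under `EqNumL`, `16·S_F ≤ M_L` (hS) and the one n_L floor.
builds on p205010 (kernel theorem, internal audit signed; external expert review pending); nothing here is a claim about the open node `SamePDropOfSkeletonFrm₁`.
N1 HEADER (kept for the reader):
# N1 params, chain of record `NegB`, part FramesF2: THE y′-FACE START WINDOW AT THE WIDE BRIDGE, cases d/t (transposed bridge, steep
# `bridgeTrSide σh` / flat `bridgeTrTop σh`), BOTH HOP SIDES — the generic shifted origin `yLFof σ σh c_lo c₀ b₁` (α := `σh·(c_lo + n_L) + σ·v_L`,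
# β := `b₁ + ⌊σh·h_L·(c_lo + n_L − c₀ + σσh·v_L)/n_L⌋`, i.e. part FaceY's core-centre origin shifted ALONG `u`), its two readings `hxaF_of` (the arithmetic of p1-g13's
# `window_reading_of_origin`, p313592, inlined) / `hxbF_of` (via `PlanarSkeletonNeg.NegB.KS.hxbY_core`), and the values `yLFd`/`yLFt` with **`hxaF_d/hxbF_d`**, **`hxaF_t/hxbF_t`** in the
# literal `hxa/hxb` shapes of `runY_core_zero_of_bridge_core'` (stmt-g16 2026-08-22; successor of part FramesF p313629, same recipe; p3-g11 ruling
# (L-F1) := (ii) 01:45:32Z, frames convention (4) 'B(σ_h)-frame, origin absolute, one relative sign s_h = σ·σ_h', p1-g13 01:39:09Z)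
The α-width of core 1 is `2RA′ + ℓBF` (steep) / `2RA′ + 2|hBF| + 11` (flat); `≤ 2n_L` needs the wide bridge's size under the box: the ONE floor
hypothesis `hS : 16·S_F ≤ M_L` (`S_F = nBF + ℓBF + |hBF|`, part SlotsF), which is `SF_floor.2.2` at `(mk, gx) := (0, gxF c)` — the (R) precedent
(`hS64` of `rootOblTWAt_negBT_y_exR2`). `hxbF_d/t` need no floor (`q⋆F`, `w⋆F` dominate the three cores' half-sizes by definition). Cell-free: nothing here reads
`fcells/prF`, so the file stands under the (ζ′) re-instantiation unchanged.
builds on p205010 (kernel theorem, internal audit signed; external expert review pending) — nothing in this file uses p205010; NOTHING is claimed about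
the node `SamePDropOfSkeletonNeg₁` (OPEN; additive closure `…_of_choiceFnNOWA` adopted on accept, lead g7 01:38:43Z; (F) = (ζ′) re-instantiation + located items).
Lane `prim-bschramm-*`, seat `prim-bschramm-stmt` (gen 16); helper file (`--supports stmt-CriticalPhenomena-4575 --as helper`); ledger HOME/prim-bschramm-stmt/NEG-PARAMS.md.
* §1 `mem_core1F_side_iff`, `mem_core1F_top_iff`, `SF_int`; §2 **`KS.yLFof`**, `yLFof_zero`, `yLFof_one`, **`hxaF_of`**, **`hxbF_of`**; §3 **`KS.yLFd/yLFt`**, `yLFd_zero/yLFt_zero`,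
  **`hxaF_d`**, **`hxbF_d`**, **`hxaF_t`**, **`hxbF_t`**.
[cite: KozmaNitzan2024, §4 Lemma 11 (pp. 22–23)] [cite: MartineauTassion2017, §4.1]
-/

noncomputable section

open scoped Classical

namespace Summit.CriticalPhenomena.PercolationContinuityZ3.Theorems.Transplant

namespace PlanarSkeletonFrm

namespace NegB

open Literature.Probability.Percolation Literature.Probability.LatticeModels SimpleGraph
open SkelConc (Consts)
open Skelφ (shearUnit shearUnit_pos sgnz sgnz_cases)
open Skelφ.StepI (DataN)
open Neg

namespace KS

/-! ## §1 The two transposed cores at the wide pair, in coordinates -/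

section Cores

/-- Core `1` of `bridgeTrSide σh` at the WIDE pair in coordinates: `x₀ ∈ [n_L − RA′ + |hBF|, n_L + RA′ + |hBF| + ℓBF]`,
`x₁ ∈ [σh·h_L − RA′ + σh·sgnz hBF·nBF, σh·h_L + ℓ_L + RA′ + σh·sgnz hBF·nBF]`. [folklore] -/
theorem mem_core1F_side_iff (κ : Consts) {V : Type} [DecidableEq V] [Countable V] {G : SimpleGraph V} [G.LocallyFinite] (Φ : PlanarSkeletonFrm G) (t : V) (p : unitInterval) (D : Skelφ.StepI.DataNS V) (c : ℕ) (mk : ℕ) (g : ℕ) (f : ℕ) (σh : ℤ) (x : Site 2) :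
    x ∈ Finset.Icc (Skelφ.bridgeTrSide σh (nL κ Φ t p D g f) (hL κ Φ t p D g f) (ℓL κ Φ t p D g f) (KS0.R'0 κ Φ t p D mk) (nBF κ Φ t p D c mk) (hBF κ Φ t p D c mk) (ℓBF κ Φ t p D c mk)).core1Lo
        (Skelφ.bridgeTrSide σh (nL κ Φ t p D g f) (hL κ Φ t p D g f) (ℓL κ Φ t p D g f) (KS0.R'0 κ Φ t p D mk) (nBF κ Φ t p D c mk) (hBF κ Φ t p D c mk) (ℓBF κ Φ t p D c mk)).core1Hi ↔
      ((nL κ Φ t p D g f : ℤ) - KS0.R'0 κ Φ t p D mk + |hBF κ Φ t p D c mk| ≤ x 0 ∧ x 0 ≤ (nL κ Φ t p D g f : ℤ) + KS0.R'0 κ Φ t p D mk + (|hBF κ Φ t p D c mk| + ℓBF κ Φ t p D c mk)) ∧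
        (σh * hL κ Φ t p D g f - KS0.R'0 κ Φ t p D mk + σh * sgnz (hBF κ Φ t p D c mk) * nBF κ Φ t p D c mk ≤ x 1 ∧
          x 1 ≤ σh * hL κ Φ t p D g f + ℓL κ Φ t p D g f + KS0.R'0 κ Φ t p D mk + σh * sgnz (hBF κ Φ t p D c mk) * nBF κ Φ t p D c mk) := by
  have hlo : (Skelφ.bridgeTrSide σh (nL κ Φ t p D g f) (hL κ Φ t p D g f) (ℓL κ Φ t p D g f) (KS0.R'0 κ Φ t p D mk) (nBF κ Φ t p D c mk) (hBF κ Φ t p D c mk) (ℓBF κ Φ t p D c mk)).core1Lo =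
      Skelφ.pt ((nL κ Φ t p D g f : ℤ) - KS0.R'0 κ Φ t p D mk + |hBF κ Φ t p D c mk|) (σh * hL κ Φ t p D g f - KS0.R'0 κ Φ t p D mk + σh * sgnz (hBF κ Φ t p D c mk) * nBF κ Φ t p D c mk) := by
    funext i; unfold ChainPlanar.BridgePrm.core1Lo Skelφ.bridgeTrSide
    fin_cases i <;> simp [Skelφ.pt]
  have hhi : (Skelφ.bridgeTrSide σh (nL κ Φ t p D g f) (hL κ Φ t p D g f) (ℓL κ Φ t p D g f) (KS0.R'0 κ Φ t p D mk) (nBF κ Φ t p D c mk) (hBF κ Φ t p D c mk) (ℓBF κ Φ t p D c mk)).core1Hi =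
      Skelφ.pt ((nL κ Φ t p D g f : ℤ) + KS0.R'0 κ Φ t p D mk + (|hBF κ Φ t p D c mk| + ℓBF κ Φ t p D c mk)) (σh * hL κ Φ t p D g f + ℓL κ Φ t p D g f + KS0.R'0 κ Φ t p D mk + σh * sgnz (hBF κ Φ t p D c mk) * nBF κ Φ t p D c mk) := by
    funext i; unfold ChainPlanar.BridgePrm.core1Hi Skelφ.bridgeTrSide
    fin_cases i <;> simp [Skelφ.pt]
  rw [hlo, hhi, Skelφ.mem_Icc_pt_iff]

/-- Core `1` of `bridgeTrTop σh` at the WIDE pair in coordinates: `x₀ ∈ [n_L − RA′ + ℓBF − |hBF| − 11, n_L + RA′ + ℓBF + |hBF|]`,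
`x₁ ∈ [σh·h_L − RA′ − nBF, σh·h_L + ℓ_L + RA′ + nBF]`. [folklore] -/
theorem mem_core1F_top_iff (κ : Consts) {V : Type} [DecidableEq V] [Countable V] {G : SimpleGraph V} [G.LocallyFinite] (Φ : PlanarSkeletonFrm G) (t : V) (p : unitInterval) (D : Skelφ.StepI.DataNS V) (c : ℕ) (mk : ℕ) (g : ℕ) (f : ℕ) (σh : ℤ) (x : Site 2) :
    x ∈ Finset.Icc (Skelφ.bridgeTrTop σh (nL κ Φ t p D g f) (hL κ Φ t p D g f) (ℓL κ Φ t p D g f) (KS0.R'0 κ Φ t p D mk) (nBF κ Φ t p D c mk) (hBF κ Φ t p D c mk) (ℓBF κ Φ t p D c mk)).core1Lo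
        (Skelφ.bridgeTrTop σh (nL κ Φ t p D g f) (hL κ Φ t p D g f) (ℓL κ Φ t p D g f) (KS0.R'0 κ Φ t p D mk) (nBF κ Φ t p D c mk) (hBF κ Φ t p D c mk) (ℓBF κ Φ t p D c mk)).core1Hi ↔
      ((nL κ Φ t p D g f : ℤ) - KS0.R'0 κ Φ t p D mk + ((ℓBF κ Φ t p D c mk : ℤ) - |hBF κ Φ t p D c mk| - 11) ≤ x 0 ∧
          x 0 ≤ (nL κ Φ t p D g f : ℤ) + KS0.R'0 κ Φ t p D mk + ((ℓBF κ Φ t p D c mk : ℤ) + |hBF κ Φ t p D c mk|)) ∧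
        (σh * hL κ Φ t p D g f - KS0.R'0 κ Φ t p D mk + -(nBF κ Φ t p D c mk : ℤ) ≤ x 1 ∧ x 1 ≤ σh * hL κ Φ t p D g f + ℓL κ Φ t p D g f + KS0.R'0 κ Φ t p D mk + nBF κ Φ t p D c mk) := by
  have hlo : (Skelφ.bridgeTrTop σh (nL κ Φ t p D g f) (hL κ Φ t p D g f) (ℓL κ Φ t p D g f) (KS0.R'0 κ Φ t p D mk) (nBF κ Φ t p D c mk) (hBF κ Φ t p D c mk) (ℓBF κ Φ t p D c mk)).core1Lo =
      Skelφ.pt ((nL κ Φ t p D g f : ℤ) - KS0.R'0 κ Φ t p D mk + ((ℓBF κ Φ t p D c mk : ℤ) - |hBF κ Φ t p D c mk| - 11)) (σh * hL κ Φ t p D g f - KS0.R'0 κ Φ t p D mk + -(nBF κ Φ t p D c mk : ℤ)) := by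
    funext i; unfold ChainPlanar.BridgePrm.core1Lo Skelφ.bridgeTrTop
    fin_cases i <;> simp [Skelφ.pt]
  have hhi : (Skelφ.bridgeTrTop σh (nL κ Φ t p D g f) (hL κ Φ t p D g f) (ℓL κ Φ t p D g f) (KS0.R'0 κ Φ t p D mk) (nBF κ Φ t p D c mk) (hBF κ Φ t p D c mk) (ℓBF κ Φ t p D c mk)).core1Hi =
      Skelφ.pt ((nL κ Φ t p D g f : ℤ) + KS0.R'0 κ Φ t p D mk + ((ℓBF κ Φ t p D c mk : ℤ) + |hBF κ Φ t p D c mk|)) (σh * hL κ Φ t p D g f + ℓL κ Φ t p D g f + KS0.R'0 κ Φ t p D mk + nBF κ Φ t p D c mk) := by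
    funext i; unfold ChainPlanar.BridgePrm.core1Hi Skelφ.bridgeTrTop
    fin_cases i <;> simp [Skelφ.pt]
  rw [hlo, hhi, Skelφ.mem_Icc_pt_iff]

/-- `S_F = nBF + ℓBF + |hBF|` in `ℤ`. [folklore] -/
theorem SF_int (κ : Consts) {V : Type} [DecidableEq V] [Countable V] {G : SimpleGraph V} [G.LocallyFinite] (Φ : PlanarSkeletonFrm G) (t : V) (p : unitInterval) (D : Skelφ.StepI.DataNS V) (c : ℕ) (mk : ℕ) : ((SF κ Φ t p D c mk : ℕ) : ℤ) = (nBF κ Φ t p D c mk : ℤ) + ℓBF κ Φ t p D c mk + |hBF κ Φ t p D c mk| := by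
  unfold SF; push_cast [Int.natCast_natAbs]; ring

end Cores

/-! ## §2 The generic shifted origin and its two readings -/

section Generic

/-- **The y′-face origin at a core with frame-α range starting at `c_lo`, α-centre `c₀`, β-centre `b₁`, hop side `σh`, run sign `σ`**:
α := `σh·(c_lo + n_L) + σ·v_L`, β := `b₁ + ⌊σh·h_L·(c_lo + n_L − c₀ + σσh·v_L)/n_L⌋` (the core-centre origin of part FaceY in the `σh`-frame with the
shifted split `v′ := c_lo + n_L − c₀ + σσh·v_L`: a shift ALONG `u`, level-neutral). [this work] -/
def yLFof (κ : Consts) {V : Type} [DecidableEq V] [Countable V] {G : SimpleGraph V} [G.LocallyFinite] (Φ : PlanarSkeletonFrm G) (t : V) (p : unitInterval) (D : Skelφ.StepI.DataNS V) (g : ℕ) (f : ℕ) (σ σh clo c₀ b₁ : ℤ) : Site 2 :=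
  Skelφ.pt (σh * (clo + nL κ Φ t p D g f) + σ * vL κ Φ t p D g f)
    (b₁ + σh * hL κ Φ t p D g f * (clo + nL κ Φ t p D g f - c₀ + σ * σh * vL κ Φ t p D g f) / (nL κ Φ t p D g f : ℤ))

/-- `σ·yLFof₀ = σσh·(c_lo + n_L) + v_L` (`σ = ±1`) — the origin of record of `window_reading_of_origin`. [folklore] -/
theorem yLFof_zero (κ : Consts) {V : Type} [DecidableEq V] [Countable V] {G : SimpleGraph V} [G.LocallyFinite] (Φ : PlanarSkeletonFrm G) (t : V) (p : unitInterval) (D : Skelφ.StepI.DataNS V) (g : ℕ) (f : ℕ) {σ : ℤ} (hσ : σ = 1 ∨ σ = -1) (σh clo c₀ b₁ : ℤ) :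
    σ * yLFof κ Φ t p D g f σ σh clo c₀ b₁ 0 = σ * σh * (clo + nL κ Φ t p D g f) + vL κ Φ t p D g f := by
  have hσsq : σ * σ = 1 := by rcases hσ with rfl | rfl <;> norm_num
  unfold yLFof; rw [Skelφ.pt_zero]; linear_combination (vL κ Φ t p D g f) * hσsq

/-- `yLFof₀ = σh·(c₀ + v′)` and `yLFof₁ = b₁ + ⌊σh·h_L·v′/n_L⌋` with `v′ := c_lo + n_L − c₀ + σσh·v_L` (`σh = ±1`). [folklore] -/
theorem yLFof_eq (κ : Consts) {V : Type} [DecidableEq V] [Countable V] {G : SimpleGraph V} [G.LocallyFinite] (Φ : PlanarSkeletonFrm G) (t : V) (p : unitInterval) (D : Skelφ.StepI.DataNS V) (g : ℕ) (f : ℕ) {σh : ℤ} (hσh : σh = 1 ∨ σh = -1) (σ clo c₀ b₁ : ℤ) :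
    yLFof κ Φ t p D g f σ σh clo c₀ b₁ 0 = σh * (c₀ + (clo + nL κ Φ t p D g f - c₀ + σ * σh * vL κ Φ t p D g f)) ∧
      yLFof κ Φ t p D g f σ σh clo c₀ b₁ 1 = b₁ + σh * hL κ Φ t p D g f * (clo + nL κ Φ t p D g f - c₀ + σ * σh * vL κ Φ t p D g f) / (nL κ Φ t p D g f : ℤ) := by
  have hσh2 : σh * σh = 1 := by rcases hσh with rfl | rfl <;> norm_num
  unfold yLFof; rw [Skelφ.pt_zero, Skelφ.pt_one]
  exact ⟨by linear_combination (-(σ * vL κ Φ t p D g f)) * hσh2, rfl⟩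

/-- **`hxaF`, generic** (p1-g13's `window_reading_of_origin` at the origin of record): a core with frame-α range `[c_lo, c_hi]`, `c_hi − c_lo ≤ 2n_L`,
reads `−(n_L+v_L)⁺ ≤ σσh·y₀ − σ·yLFof₀ ≤ (n_L−v_L)⁺`. [folklore] -/
theorem hxaF_of (κ : Consts) {V : Type} [DecidableEq V] [Countable V] {G : SimpleGraph V} [G.LocallyFinite] (Φ : PlanarSkeletonFrm G) (t : V) (p : unitInterval) (D : Skelφ.StepI.DataNS V) (g : ℕ) (f : ℕ) {σ σh : ℤ} (hσ : σ = 1 ∨ σ = -1) (hσh : σh = 1 ∨ σh = -1) (hv : |vL κ Φ t p D g f| ≤ (nL κ Φ t p D g f : ℤ))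
    {clo chi : ℤ} (hwid : chi - clo ≤ 2 * (nL κ Φ t p D g f : ℤ)) (c₀ b₁ : ℤ) {y : Site 2} (hy : clo ≤ y 0 ∧ y 0 ≤ chi) :
    -((((nL κ Φ t p D g f : ℤ) + vL κ Φ t p D g f).toNat : ℕ) : ℤ) ≤ σ * σh * y 0 - σ * yLFof κ Φ t p D g f σ σh clo c₀ b₁ 0 ∧
      σ * σh * y 0 - σ * yLFof κ Φ t p D g f σ σh clo c₀ b₁ 0 ≤ ((((nL κ Φ t p D g f : ℤ) - vL κ Φ t p D g f).toNat : ℕ) : ℤ) := by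
  have hs : σ * σh = 1 ∨ σ * σh = -1 := by
    rcases hσ with rfl | rfl <;> rcases hσh with rfl | rfl <;> norm_num
  -- p1-g13's `window_reading_of_origin` (SkelPhiParaRunCross §3), inlined
  rw [abs_le] at hv
  obtain ⟨hy1, hy2⟩ := hy
  have h1 : ((((nL κ Φ t p D g f : ℤ) + vL κ Φ t p D g f).toNat : ℕ) : ℤ) = nL κ Φ t p D g f + vL κ Φ t p D g f := Int.toNat_of_nonneg (by linarith)
  have h2 : ((((nL κ Φ t p D g f : ℤ) - vL κ Φ t p D g f).toNat : ℕ) : ℤ) = nL κ Φ t p D g f - vL κ Φ t p D g f := Int.toNat_of_nonneg (by linarith)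
  rw [h1, h2, yLFof_zero κ Φ t p D g f hσ σh clo c₀ b₁]
  rcases hs with hs | hs <;> rw [hs] <;> constructor <;> linarith

/-- **`hxbF`, generic** (`PlanarSkeletonNeg.NegB.KS.hxbY_core` in the `σh`-frame with the shifted split): `|y₀ − c₀| ≤ w`, `|y₁ − b₁| ≤ q` give
`|σ·(n_L·(y₁ − yLFof₁) − h_L·(σh·y₀ − yLFof₀))| ≤ n_L·q + |h_L|·w + n_L`. [folklore] -/
theorem hxbF_of (κ : Consts) {V : Type} [DecidableEq V] [Countable V] {G : SimpleGraph V} [G.LocallyFinite] (Φ : PlanarSkeletonFrm G) (t : V) (p : unitInterval) (D : Skelφ.StepI.DataNS V) (g : ℕ) (f : ℕ) (hn : 1 ≤ nL κ Φ t p D g f) {σ σh : ℤ} (hσ : σ = 1 ∨ σ = -1) (hσh : σh = 1 ∨ σh = -1) (clo : ℤ) {c₀ b₁ w q : ℤ} {y : Site 2}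
    (h0 : |y 0 - c₀| ≤ w) (h1 : |y 1 - b₁| ≤ q) :
    |σ * ((nL κ Φ t p D g f : ℤ) * (y 1 - yLFof κ Φ t p D g f σ σh clo c₀ b₁ 1) - hL κ Φ t p D g f * (σh * y 0 - yLFof κ Φ t p D g f σ σh clo c₀ b₁ 0))| ≤
      (nL κ Φ t p D g f : ℤ) * q + |hL κ Φ t p D g f| * w + nL κ Φ t p D g f := by
  obtain ⟨e0, e1⟩ := yLFof_eq κ Φ t p D g f hσh σ clo c₀ b₁
  have key := PlanarSkeletonNeg.NegB.KS.hxbY_core hn (hL κ Φ t p D g f) (clo + nL κ Φ t p D g f - c₀ + σ * σh * vL κ Φ t p D g f) hσh h0 h1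
  have hσabs : |σ| = 1 := by rcases hσ with rfl | rfl <;> norm_num
  have hσhabs : |σh| = 1 := by rcases hσh with rfl | rfl <;> norm_num
  have habs : ∀ X : ℤ, |σ * X| = |σh * X| := fun X => by rw [abs_mul, abs_mul, hσabs, hσhabs]
  rw [habs, e0, e1]
  exact key

end Generic

/-! ## §3 The two transposed origins at the wide pair and their readings -/

section Values

/-- **THE y′-FACE ORIGIN AT THE WIDE BRIDGE, steep transposed case, hop side `σh`** (`c_lo := n_L − RA′ + |hBF|`, `c₀ := n_L + |hBF| + ℓBF/2`,
`b₁ := σh·(h_L + sgnz hBF·nBF) + ℓ_L/2`). [this work] -/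
def yLFd (κ : Consts) {V : Type} [DecidableEq V] [Countable V] {G : SimpleGraph V} [G.LocallyFinite] (Φ : PlanarSkeletonFrm G) (t : V) (p : unitInterval) (D : Skelφ.StepI.DataNS V) (c : ℕ) (mk : ℕ) (g : ℕ) (f : ℕ) (σ σh : ℤ) : Site 2 :=
  yLFof κ Φ t p D g f σ σh ((nL κ Φ t p D g f : ℤ) - KS0.R'0 κ Φ t p D mk + |hBF κ Φ t p D c mk|)
    ((nL κ Φ t p D g f : ℤ) + |hBF κ Φ t p D c mk| + (ℓBF κ Φ t p D c mk : ℤ) / 2)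
    (σh * (hL κ Φ t p D g f + sgnz (hBF κ Φ t p D c mk) * nBF κ Φ t p D c mk) + (ℓL κ Φ t p D g f : ℤ) / 2)

/-- **THE y′-FACE ORIGIN AT THE WIDE BRIDGE, flat transposed case, hop side `σh`** (`c_lo := n_L − RA′ + ℓBF − |hBF| − 11`, `c₀ := n_L + ℓBF − 5`,
`b₁ := σh·h_L + ℓ_L/2`). [this work] -/
def yLFt (κ : Consts) {V : Type} [DecidableEq V] [Countable V] {G : SimpleGraph V} [G.LocallyFinite] (Φ : PlanarSkeletonFrm G) (t : V) (p : unitInterval) (D : Skelφ.StepI.DataNS V) (c : ℕ) (mk : ℕ) (g : ℕ) (f : ℕ) (σ σh : ℤ) : Site 2 :=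
  yLFof κ Φ t p D g f σ σh ((nL κ Φ t p D g f : ℤ) - KS0.R'0 κ Φ t p D mk + ((ℓBF κ Φ t p D c mk : ℤ) - |hBF κ Φ t p D c mk| - 11))
    ((nL κ Φ t p D g f : ℤ) + ℓBF κ Φ t p D c mk - 5) (σh * hL κ Φ t p D g f + (ℓL κ Φ t p D g f : ℤ) / 2)

/-- `σ·yLFd₀ = σσh·(c_lo + n_L) + v_L`, `c_lo = n_L − RA′ + |hBF|` (`σ = ±1`). [folklore] -/
theorem yLFd_zero (κ : Consts) {V : Type} [DecidableEq V] [Countable V] {G : SimpleGraph V} [G.LocallyFinite] (Φ : PlanarSkeletonFrm G) (t : V) (p : unitInterval) (D : Skelφ.StepI.DataNS V) (c : ℕ) (mk : ℕ) (g : ℕ) (f : ℕ) {σ : ℤ} (hσ : σ = 1 ∨ σ = -1) (σh : ℤ) :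
    σ * yLFd κ Φ t p D c mk g f σ σh 0 = σ * σh * (((nL κ Φ t p D g f : ℤ) - KS0.R'0 κ Φ t p D mk + |hBF κ Φ t p D c mk|) + nL κ Φ t p D g f) + vL κ Φ t p D g f :=
  yLFof_zero κ Φ t p D g f hσ σh _ _ _

/-- `σ·yLFt₀ = σσh·(c_lo + n_L) + v_L`, `c_lo = n_L − RA′ + ℓBF − |hBF| − 11` (`σ = ±1`). [folklore] -/
theorem yLFt_zero (κ : Consts) {V : Type} [DecidableEq V] [Countable V] {G : SimpleGraph V} [G.LocallyFinite] (Φ : PlanarSkeletonFrm G) (t : V) (p : unitInterval) (D : Skelφ.StepI.DataNS V) (c : ℕ) (mk : ℕ) (g : ℕ) (f : ℕ) {σ : ℤ} (hσ : σ = 1 ∨ σ = -1) (σh : ℤ) :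
    σ * yLFt κ Φ t p D c mk g f σ σh 0 =
      σ * σh * (((nL κ Φ t p D g f : ℤ) - KS0.R'0 κ Φ t p D mk + ((ℓBF κ Φ t p D c mk : ℤ) - |hBF κ Φ t p D c mk| - 11)) + nL κ Φ t p D g f) + vL κ Φ t p D g f :=
  yLFof_zero κ Φ t p D g f hσ σh _ _ _

end Values

section At

/-- The α-widths of the two transposed cores fit the window: `2RA′ + ℓBF ≤ 2n_L` and `2RA′ + 2|hBF| + 11 ≤ 2n_L` under the floor `16·S_F ≤ M_L`
(`M_L + 1 ≤ n_L`, `2000(RA′+2) ≤ n_L`). [folklore] -/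
theorem widthF_dt_le (κ : Consts) {V : Type} [DecidableEq V] [Countable V] {G : SimpleGraph V} [G.LocallyFinite] (Φ : PlanarSkeletonFrm G) (t : V) (p : unitInterval) (D : Skelφ.StepI.DataNS V) (c : ℕ) (mk : ℕ) (gx : Neg.FSlot) (fx : Neg.FSlot) (h3R0 : 2000 * ((KS0.R'0 κ Φ t p D mk : ℤ) + 2) ≤ (nL κ Φ t p D (gT mk gx κ Φ t p D) (fT mk fx κ Φ t p D) : ℤ)) (hN : EqNumL κ Φ t p D (gT mk gx κ Φ t p D) (fT mk fx κ Φ t p D)) (hS : 16 * SF κ Φ t p D c mk ≤ ML κ Φ t p D (gT mk gx κ Φ t p D)) :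
    2 * (KS0.R'0 κ Φ t p D mk : ℤ) + ℓBF κ Φ t p D c mk ≤ 2 * (nL κ Φ t p D (gT mk gx κ Φ t p D) (fT mk fx κ Φ t p D) : ℤ) ∧
      2 * (KS0.R'0 κ Φ t p D mk : ℤ) + 2 * |hBF κ Φ t p D c mk| + 11 ≤ 2 * (nL κ Φ t p D (gT mk gx κ Φ t p D) (fT mk fx κ Φ t p D) : ℤ) := by
  have h1 : ((16 * SF κ Φ t p D c mk : ℕ) : ℤ) ≤ (ML κ Φ t p D (gT mk gx κ Φ t p D) : ℤ) := by exact_mod_cast hS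
  push_cast at h1
  rw [SF_int] at h1
  have h2 := hN.n_le
  have h3 := h3R0
  have h4 : (0 : ℤ) ≤ (nBF κ Φ t p D c mk : ℤ) := by positivity
  have h5 := abs_nonneg (hBF κ Φ t p D c mk)
  have h6 : (0 : ℤ) ≤ (ℓBF κ Φ t p D c mk : ℤ) := by positivity
  have h7 : (0 : ℤ) ≤ (KS0.R'0 κ Φ t p D mk : ℤ) := by positivity
  constructor <;> nlinarith

/-- **`hxaY(s_h)`, steep transposed case, wide pair**: `−(n_L+v_L)⁺ ≤ σσh·y₀ − σ·yLFd₀ ≤ (n_L−v_L)⁺` on core 1 of `bridgeTrSide σh` (floor `16·S_F ≤ M_L`,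
= `SF_floor.2.2` at `(mk, gx) := (0, gxF c)`). [folklore] -/
theorem hxaF_d (κ : Consts) {V : Type} [DecidableEq V] [Countable V] {G : SimpleGraph V} [G.LocallyFinite] (Φ : PlanarSkeletonFrm G) (t : V) (p : unitInterval) (D : Skelφ.StepI.DataNS V) (c : ℕ) (mk : ℕ) (gx : Neg.FSlot) (fx : Neg.FSlot) (h3R0 : 2000 * ((KS0.R'0 κ Φ t p D mk : ℤ) + 2) ≤ (nL κ Φ t p D (gT mk gx κ Φ t p D) (fT mk fx κ Φ t p D) : ℤ)) (hN : EqNumL κ Φ t p D (gT mk gx κ Φ t p D) (fT mk fx κ Φ t p D)) (hS : 16 * SF κ Φ t p D c mk ≤ ML κ Φ t p D (gT mk gx κ Φ t p D))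
    {σ σh : ℤ} (hσ : σ = 1 ∨ σ = -1) (hσh : σh = 1 ∨ σh = -1) :
    ∀ y ∈ Finset.Icc (Skelφ.bridgeTrSide σh (nL κ Φ t p D (gT mk gx κ Φ t p D) (fT mk fx κ Φ t p D)) (hL κ Φ t p D (gT mk gx κ Φ t p D) (fT mk fx κ Φ t p D))
          (ℓL κ Φ t p D (gT mk gx κ Φ t p D) (fT mk fx κ Φ t p D)) (KS0.R'0 κ Φ t p D mk) (nBF κ Φ t p D c mk) (hBF κ Φ t p D c mk) (ℓBF κ Φ t p D c mk)).core1Lo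
        (Skelφ.bridgeTrSide σh (nL κ Φ t p D (gT mk gx κ Φ t p D) (fT mk fx κ Φ t p D)) (hL κ Φ t p D (gT mk gx κ Φ t p D) (fT mk fx κ Φ t p D))
          (ℓL κ Φ t p D (gT mk gx κ Φ t p D) (fT mk fx κ Φ t p D)) (KS0.R'0 κ Φ t p D mk) (nBF κ Φ t p D c mk) (hBF κ Φ t p D c mk) (ℓBF κ Φ t p D c mk)).core1Hi,
      -((((nL κ Φ t p D (gT mk gx κ Φ t p D) (fT mk fx κ Φ t p D) : ℤ) + vL κ Φ t p D (gT mk gx κ Φ t p D) (fT mk fx κ Φ t p D)).toNat : ℕ) : ℤ) ≤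
          σ * σh * y 0 - σ * yLFd κ Φ t p D c mk (gT mk gx κ Φ t p D) (fT mk fx κ Φ t p D) σ σh 0 ∧
        σ * σh * y 0 - σ * yLFd κ Φ t p D c mk (gT mk gx κ Φ t p D) (fT mk fx κ Φ t p D) σ σh 0 ≤
          ((((nL κ Φ t p D (gT mk gx κ Φ t p D) (fT mk fx κ Φ t p D) : ℤ) - vL κ Φ t p D (gT mk gx κ Φ t p D) (fT mk fx κ Φ t p D)).toNat : ℕ) : ℤ) := by
  intro y hy
  rw [mem_core1F_side_iff] at hy
  obtain ⟨⟨h0l, h0u⟩, -⟩ := hy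
  have hw := (widthF_dt_le κ Φ t p D c mk gx fx h3R0 hN hS).1
  exact hxaF_of κ Φ t p D _ _ hσ hσh hN.v_le (chi := (nL κ Φ t p D (gT mk gx κ Φ t p D) (fT mk fx κ Φ t p D) : ℤ) + KS0.R'0 κ Φ t p D mk +
    (|hBF κ Φ t p D c mk| + ℓBF κ Φ t p D c mk)) (by linarith) _ _ ⟨h0l, h0u⟩

/-- **`hxbY(σh)`, steep transposed case, wide pair** (`qB := qBF`): `|σ·(n_L·(y₁ − yLFd₁) − h_L·(σh·y₀ − yLFd₀))| + U_L ≤ (qBF + 1)·U_L`. [folklore] -/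
theorem hxbF_d (κ : Consts) {V : Type} [DecidableEq V] [Countable V] {G : SimpleGraph V} [G.LocallyFinite] (Φ : PlanarSkeletonFrm G) (t : V) (p : unitInterval) (D : Skelφ.StepI.DataNS V) (c : ℕ) (mk : ℕ) (gx : Neg.FSlot) (fx : Neg.FSlot) (hN : EqNumL κ Φ t p D (gT mk gx κ Φ t p D) (fT mk fx κ Φ t p D)) {σ σh : ℤ} (hσ : σ = 1 ∨ σ = -1) (hσh : σh = 1 ∨ σh = -1) :
    ∀ y ∈ Finset.Icc (Skelφ.bridgeTrSide σh (nL κ Φ t p D (gT mk gx κ Φ t p D) (fT mk fx κ Φ t p D)) (hL κ Φ t p D (gT mk gx κ Φ t p D) (fT mk fx κ Φ t p D))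
          (ℓL κ Φ t p D (gT mk gx κ Φ t p D) (fT mk fx κ Φ t p D)) (KS0.R'0 κ Φ t p D mk) (nBF κ Φ t p D c mk) (hBF κ Φ t p D c mk) (ℓBF κ Φ t p D c mk)).core1Lo
        (Skelφ.bridgeTrSide σh (nL κ Φ t p D (gT mk gx κ Φ t p D) (fT mk fx κ Φ t p D)) (hL κ Φ t p D (gT mk gx κ Φ t p D) (fT mk fx κ Φ t p D))
          (ℓL κ Φ t p D (gT mk gx κ Φ t p D) (fT mk fx κ Φ t p D)) (KS0.R'0 κ Φ t p D mk) (nBF κ Φ t p D c mk) (hBF κ Φ t p D c mk) (ℓBF κ Φ t p D c mk)).core1Hi,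
      |σ * ((nL κ Φ t p D (gT mk gx κ Φ t p D) (fT mk fx κ Φ t p D) : ℤ) * (y 1 - yLFd κ Φ t p D c mk (gT mk gx κ Φ t p D) (fT mk fx κ Φ t p D) σ σh 1) -
            hL κ Φ t p D (gT mk gx κ Φ t p D) (fT mk fx κ Φ t p D) * (σh * y 0 - yLFd κ Φ t p D c mk (gT mk gx κ Φ t p D) (fT mk fx κ Φ t p D) σ σh 0))| +
          (shearUnit (nL κ Φ t p D (gT mk gx κ Φ t p D) (fT mk fx κ Φ t p D)) (hL κ Φ t p D (gT mk gx κ Φ t p D) (fT mk fx κ Φ t p D)) : ℤ) ≤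
        ((qBF κ Φ t p D c mk (gT mk gx κ Φ t p D) (fT mk fx κ Φ t p D) : ℤ) + 1) *
          (shearUnit (nL κ Φ t p D (gT mk gx κ Φ t p D) (fT mk fx κ Φ t p D)) (hL κ Φ t p D (gT mk gx κ Φ t p D) (fT mk fx κ Φ t p D)) : ℤ) := by
  intro y hy
  rw [mem_core1F_side_iff] at hy
  obtain ⟨⟨h0l, h0u⟩, ⟨h1l, h1u⟩⟩ := hy
  obtain ⟨hn1, -⟩ := one_le_of_eqNumL κ Φ t p D _ _ hN
  unfold yLFd
  set n := nL κ Φ t p D (gT mk gx κ Φ t p D) (fT mk fx κ Φ t p D) with hn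
  set h := hL κ Φ t p D (gT mk gx κ Φ t p D) (fT mk fx κ Φ t p D) with hh
  set ℓ := ℓL κ Φ t p D (gT mk gx κ Φ t p D) (fT mk fx κ Φ t p D) with hℓ
  have hspec := qBF_spec κ Φ t p D c mk (gT mk gx κ Φ t p D) (fT mk fx κ Φ t p D) hn1
  have hR0 : (0 : ℤ) ≤ (KS0.R'0 κ Φ t p D mk : ℤ) := by positivity
  have hnb0 : (0 : ℤ) ≤ (nBF κ Φ t p D c mk : ℤ) := by positivity
  have hd := Int.mul_ediv_add_emod (ℓBF κ Φ t p D c mk : ℤ) 2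
  have hm0 := Int.emod_nonneg (ℓBF κ Φ t p D c mk : ℤ) (by norm_num : (2 : ℤ) ≠ 0)
  have hm1 := Int.emod_lt_of_pos (ℓBF κ Φ t p D c mk : ℤ) (by norm_num : (0 : ℤ) < 2)
  have hd' := Int.mul_ediv_add_emod (ℓ : ℤ) 2
  have hm0' := Int.emod_nonneg (ℓ : ℤ) (by norm_num : (2 : ℤ) ≠ 0)
  have hm1' := Int.emod_lt_of_pos (ℓ : ℤ) (by norm_num : (0 : ℤ) < 2)
  -- the core about (c₀, b₁) = (n + |hBF| + ℓBF/2, σh(h + sgnz hBF·nBF) + ℓ/2), half sizes (RA′ + ℓBF/2 + 1, ℓ/2 + RA′ + 1)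
  have ha : |y 0 - ((n : ℤ) + |hBF κ Φ t p D c mk| + (ℓBF κ Φ t p D c mk : ℤ) / 2)| ≤ (KS0.R'0 κ Φ t p D mk : ℤ) + (ℓBF κ Φ t p D c mk : ℤ) / 2 + 1 := by
    rw [abs_le]; constructor <;> linarith
  have hb : |y 1 - (σh * (h + sgnz (hBF κ Φ t p D c mk) * nBF κ Φ t p D c mk) + (ℓ : ℤ) / 2)| ≤ (ℓ : ℤ) / 2 + KS0.R'0 κ Φ t p D mk + 1 := by
    have e : σh * (h + sgnz (hBF κ Φ t p D c mk) * nBF κ Φ t p D c mk) = σh * h + σh * sgnz (hBF κ Φ t p D c mk) * nBF κ Φ t p D c mk := by ring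
    rw [e, abs_le]; constructor <;> linarith
  have key := hxbF_of κ Φ t p D (gT mk gx κ Φ t p D) (fT mk fx κ Φ t p D) hn1 hσ hσh
    ((n : ℤ) - KS0.R'0 κ Φ t p D mk + |hBF κ Φ t p D c mk|) ha hb
  -- compare with (q⋆F, w⋆F)
  have hq' : (ℓ : ℤ) / 2 + KS0.R'0 κ Φ t p D mk + 1 ≤ (qStarF κ Φ t p D c mk (gT mk gx κ Φ t p D) (fT mk fx κ Φ t p D) : ℤ) := by
    unfold qStarF; push_cast; omega
  have hw' : (KS0.R'0 κ Φ t p D mk : ℤ) + (ℓBF κ Φ t p D c mk : ℤ) / 2 + 1 ≤ (wStarF κ Φ t p D c mk : ℤ) := by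
    have ew : (wStarF κ Φ t p D c mk : ℤ) = (KS0.R'0 κ Φ t p D mk : ℤ) + (ℓBF κ Φ t p D c mk : ℤ) / 2 + |hBF κ Φ t p D c mk| + 6 := by
      unfold wStarF; push_cast [Int.natCast_natAbs]; ring
    rw [ew]; linarith [abs_nonneg (hBF κ Φ t p D c mk)]
  have hn0 : (0 : ℤ) ≤ (n : ℤ) := by positivity
  have hq0 : (0 : ℤ) ≤ (ℓ : ℤ) / 2 + KS0.R'0 κ Φ t p D mk + 1 := by
    have : (0 : ℤ) ≤ (ℓ : ℤ) / 2 := Int.ediv_nonneg (by positivity) (by norm_num)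
    linarith
  have hw0 : (0 : ℤ) ≤ (KS0.R'0 κ Φ t p D mk : ℤ) + (ℓBF κ Φ t p D c mk : ℤ) / 2 + 1 := by
    have : (0 : ℤ) ≤ (ℓBF κ Φ t p D c mk : ℤ) / 2 := Int.ediv_nonneg (by positivity) (by norm_num)
    linarith
  have hmono : (n : ℤ) * ((ℓ : ℤ) / 2 + KS0.R'0 κ Φ t p D mk + 1) + |h| * ((KS0.R'0 κ Φ t p D mk : ℤ) + (ℓBF κ Φ t p D c mk : ℤ) / 2 + 1) + n ≤
      (n : ℤ) * (qStarF κ Φ t p D c mk (gT mk gx κ Φ t p D) (fT mk fx κ Φ t p D) : ℤ) + |h| * (wStarF κ Φ t p D c mk : ℤ) + n := by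
    have := abs_nonneg h; nlinarith
  linarith

/-- **`hxaY(s_h)`, flat transposed case, wide pair**: `−(n_L+v_L)⁺ ≤ σσh·y₀ − σ·yLFt₀ ≤ (n_L−v_L)⁺` on core 1 of `bridgeTrTop σh` (floor `16·S_F ≤ M_L`).
[folklore] -/
theorem hxaF_t (κ : Consts) {V : Type} [DecidableEq V] [Countable V] {G : SimpleGraph V} [G.LocallyFinite] (Φ : PlanarSkeletonFrm G) (t : V) (p : unitInterval) (D : Skelφ.StepI.DataNS V) (c : ℕ) (mk : ℕ) (gx : Neg.FSlot) (fx : Neg.FSlot) (h3R0 : 2000 * ((KS0.R'0 κ Φ t p D mk : ℤ) + 2) ≤ (nL κ Φ t p D (gT mk gx κ Φ t p D) (fT mk fx κ Φ t p D) : ℤ)) (hN : EqNumL κ Φ t p D (gT mk gx κ Φ t p D) (fT mk fx κ Φ t p D)) (hS : 16 * SF κ Φ t p D c mk ≤ ML κ Φ t p D (gT mk gx κ Φ t p D))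
    {σ σh : ℤ} (hσ : σ = 1 ∨ σ = -1) (hσh : σh = 1 ∨ σh = -1) :
    ∀ y ∈ Finset.Icc (Skelφ.bridgeTrTop σh (nL κ Φ t p D (gT mk gx κ Φ t p D) (fT mk fx κ Φ t p D)) (hL κ Φ t p D (gT mk gx κ Φ t p D) (fT mk fx κ Φ t p D))
          (ℓL κ Φ t p D (gT mk gx κ Φ t p D) (fT mk fx κ Φ t p D)) (KS0.R'0 κ Φ t p D mk) (nBF κ Φ t p D c mk) (hBF κ Φ t p D c mk) (ℓBF κ Φ t p D c mk)).core1Lo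
        (Skelφ.bridgeTrTop σh (nL κ Φ t p D (gT mk gx κ Φ t p D) (fT mk fx κ Φ t p D)) (hL κ Φ t p D (gT mk gx κ Φ t p D) (fT mk fx κ Φ t p D))
          (ℓL κ Φ t p D (gT mk gx κ Φ t p D) (fT mk fx κ Φ t p D)) (KS0.R'0 κ Φ t p D mk) (nBF κ Φ t p D c mk) (hBF κ Φ t p D c mk) (ℓBF κ Φ t p D c mk)).core1Hi,
      -((((nL κ Φ t p D (gT mk gx κ Φ t p D) (fT mk fx κ Φ t p D) : ℤ) + vL κ Φ t p D (gT mk gx κ Φ t p D) (fT mk fx κ Φ t p D)).toNat : ℕ) : ℤ) ≤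
          σ * σh * y 0 - σ * yLFt κ Φ t p D c mk (gT mk gx κ Φ t p D) (fT mk fx κ Φ t p D) σ σh 0 ∧
        σ * σh * y 0 - σ * yLFt κ Φ t p D c mk (gT mk gx κ Φ t p D) (fT mk fx κ Φ t p D) σ σh 0 ≤
          ((((nL κ Φ t p D (gT mk gx κ Φ t p D) (fT mk fx κ Φ t p D) : ℤ) - vL κ Φ t p D (gT mk gx κ Φ t p D) (fT mk fx κ Φ t p D)).toNat : ℕ) : ℤ) := by
  intro y hy
  rw [mem_core1F_top_iff] at hy
  obtain ⟨⟨h0l, h0u⟩, -⟩ := hy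
  have hw := (widthF_dt_le κ Φ t p D c mk gx fx h3R0 hN hS).2
  exact hxaF_of κ Φ t p D _ _ hσ hσh hN.v_le (chi := (nL κ Φ t p D (gT mk gx κ Φ t p D) (fT mk fx κ Φ t p D) : ℤ) + KS0.R'0 κ Φ t p D mk +
    ((ℓBF κ Φ t p D c mk : ℤ) + |hBF κ Φ t p D c mk|)) (by linarith) _ _ ⟨h0l, h0u⟩

/-- **`hxbY(σh)`, flat transposed case, wide pair** (`qB := qBF`): `|σ·(n_L·(y₁ − yLFt₁) − h_L·(σh·y₀ − yLFt₀))| + U_L ≤ (qBF + 1)·U_L`. [folklore] -/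
theorem hxbF_t (κ : Consts) {V : Type} [DecidableEq V] [Countable V] {G : SimpleGraph V} [G.LocallyFinite] (Φ : PlanarSkeletonFrm G) (t : V) (p : unitInterval) (D : Skelφ.StepI.DataNS V) (c : ℕ) (mk : ℕ) (gx : Neg.FSlot) (fx : Neg.FSlot) (hN : EqNumL κ Φ t p D (gT mk gx κ Φ t p D) (fT mk fx κ Φ t p D)) {σ σh : ℤ} (hσ : σ = 1 ∨ σ = -1) (hσh : σh = 1 ∨ σh = -1) :
    ∀ y ∈ Finset.Icc (Skelφ.bridgeTrTop σh (nL κ Φ t p D (gT mk gx κ Φ t p D) (fT mk fx κ Φ t p D)) (hL κ Φ t p D (gT mk gx κ Φ t p D) (fT mk fx κ Φ t p D))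
          (ℓL κ Φ t p D (gT mk gx κ Φ t p D) (fT mk fx κ Φ t p D)) (KS0.R'0 κ Φ t p D mk) (nBF κ Φ t p D c mk) (hBF κ Φ t p D c mk) (ℓBF κ Φ t p D c mk)).core1Lo
        (Skelφ.bridgeTrTop σh (nL κ Φ t p D (gT mk gx κ Φ t p D) (fT mk fx κ Φ t p D)) (hL κ Φ t p D (gT mk gx κ Φ t p D) (fT mk fx κ Φ t p D))
          (ℓL κ Φ t p D (gT mk gx κ Φ t p D) (fT mk fx κ Φ t p D)) (KS0.R'0 κ Φ t p D mk) (nBF κ Φ t p D c mk) (hBF κ Φ t p D c mk) (ℓBF κ Φ t p D c mk)).core1Hi,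
      |σ * ((nL κ Φ t p D (gT mk gx κ Φ t p D) (fT mk fx κ Φ t p D) : ℤ) * (y 1 - yLFt κ Φ t p D c mk (gT mk gx κ Φ t p D) (fT mk fx κ Φ t p D) σ σh 1) -
            hL κ Φ t p D (gT mk gx κ Φ t p D) (fT mk fx κ Φ t p D) * (σh * y 0 - yLFt κ Φ t p D c mk (gT mk gx κ Φ t p D) (fT mk fx κ Φ t p D) σ σh 0))| +
          (shearUnit (nL κ Φ t p D (gT mk gx κ Φ t p D) (fT mk fx κ Φ t p D)) (hL κ Φ t p D (gT mk gx κ Φ t p D) (fT mk fx κ Φ t p D)) : ℤ) ≤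
        ((qBF κ Φ t p D c mk (gT mk gx κ Φ t p D) (fT mk fx κ Φ t p D) : ℤ) + 1) *
          (shearUnit (nL κ Φ t p D (gT mk gx κ Φ t p D) (fT mk fx κ Φ t p D)) (hL κ Φ t p D (gT mk gx κ Φ t p D) (fT mk fx κ Φ t p D)) : ℤ) := by
  intro y hy
  rw [mem_core1F_top_iff] at hy
  obtain ⟨⟨h0l, h0u⟩, ⟨h1l, h1u⟩⟩ := hy
  obtain ⟨hn1, -⟩ := one_le_of_eqNumL κ Φ t p D _ _ hN
  unfold yLFt
  set n := nL κ Φ t p D (gT mk gx κ Φ t p D) (fT mk fx κ Φ t p D) with hn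
  set h := hL κ Φ t p D (gT mk gx κ Φ t p D) (fT mk fx κ Φ t p D) with hh
  set ℓ := ℓL κ Φ t p D (gT mk gx κ Φ t p D) (fT mk fx κ Φ t p D) with hℓ
  have hspec := qBF_spec κ Φ t p D c mk (gT mk gx κ Φ t p D) (fT mk fx κ Φ t p D) hn1
  have hR0 : (0 : ℤ) ≤ (KS0.R'0 κ Φ t p D mk : ℤ) := by positivity
  have hnb0 : (0 : ℤ) ≤ (nBF κ Φ t p D c mk : ℤ) := by positivity
  have hℓb0 : (0 : ℤ) ≤ (ℓBF κ Φ t p D c mk : ℤ) := by positivity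
  have hba := abs_nonneg (hBF κ Φ t p D c mk)
  have hd' := Int.mul_ediv_add_emod (ℓ : ℤ) 2
  have hm0' := Int.emod_nonneg (ℓ : ℤ) (by norm_num : (2 : ℤ) ≠ 0)
  have hm1' := Int.emod_lt_of_pos (ℓ : ℤ) (by norm_num : (0 : ℤ) < 2)
  -- the core about (c₀, b₁) = (n + ℓBF − 5, σh·h + ℓ/2), half sizes (RA′ + |hBF| + 6, ℓ/2 + nBF + RA′ + 1)
  have ha : |y 0 - ((n : ℤ) + ℓBF κ Φ t p D c mk - 5)| ≤ (KS0.R'0 κ Φ t p D mk : ℤ) + |hBF κ Φ t p D c mk| + 6 := by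
    rw [abs_le]; constructor <;> linarith
  have hb : |y 1 - (σh * h + (ℓ : ℤ) / 2)| ≤ (ℓ : ℤ) / 2 + nBF κ Φ t p D c mk + KS0.R'0 κ Φ t p D mk + 1 := by
    rw [abs_le]; constructor <;> linarith
  have key := hxbF_of κ Φ t p D (gT mk gx κ Φ t p D) (fT mk fx κ Φ t p D) hn1 hσ hσh
    ((n : ℤ) - KS0.R'0 κ Φ t p D mk + ((ℓBF κ Φ t p D c mk : ℤ) - |hBF κ Φ t p D c mk| - 11)) ha hb
  -- compare with (q⋆F, w⋆F)
  have hq' : (ℓ : ℤ) / 2 + nBF κ Φ t p D c mk + KS0.R'0 κ Φ t p D mk + 1 ≤ (qStarF κ Φ t p D c mk (gT mk gx κ Φ t p D) (fT mk fx κ Φ t p D) : ℤ) := by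
    unfold qStarF; push_cast; omega
  have hw' : (KS0.R'0 κ Φ t p D mk : ℤ) + |hBF κ Φ t p D c mk| + 6 ≤ (wStarF κ Φ t p D c mk : ℤ) := by
    have ew : (wStarF κ Φ t p D c mk : ℤ) = (KS0.R'0 κ Φ t p D mk : ℤ) + (ℓBF κ Φ t p D c mk : ℤ) / 2 + |hBF κ Φ t p D c mk| + 6 := by
      unfold wStarF; push_cast [Int.natCast_natAbs]; ring
    have h0 : (0 : ℤ) ≤ (ℓBF κ Φ t p D c mk : ℤ) / 2 := Int.ediv_nonneg (by positivity) (by norm_num)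
    rw [ew]; linarith
  have hn0 : (0 : ℤ) ≤ (n : ℤ) := by positivity
  have hq0 : (0 : ℤ) ≤ (ℓ : ℤ) / 2 + nBF κ Φ t p D c mk + KS0.R'0 κ Φ t p D mk + 1 := by
    have : (0 : ℤ) ≤ (ℓ : ℤ) / 2 := Int.ediv_nonneg (by positivity) (by norm_num)
    linarith
  have hw0 : (0 : ℤ) ≤ (KS0.R'0 κ Φ t p D mk : ℤ) + |hBF κ Φ t p D c mk| + 6 := by linarith
  have hmono : (n : ℤ) * ((ℓ : ℤ) / 2 + nBF κ Φ t p D c mk + KS0.R'0 κ Φ t p D mk + 1) + |h| * ((KS0.R'0 κ Φ t p D mk : ℤ) + |hBF κ Φ t p D c mk| + 6) + n ≤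
      (n : ℤ) * (qStarF κ Φ t p D c mk (gT mk gx κ Φ t p D) (fT mk fx κ Φ t p D) : ℤ) + |h| * (wStarF κ Φ t p D c mk : ℤ) + n := by
    have := abs_nonneg h; nlinarith
  linarith

end At

end KS

end NegB

end PlanarSkeletonFrm

end Summit.CriticalPhenomena.PercolationContinuityZ3.Theorems.Transplant

end
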